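import Summits.BirchSwinnertonDyer.BirchSwinnertonDyer.Theorems.QuadraticBranchSignedControlPlusEtaNonsurjCMConjAAnchorTransfer
import Summits.BirchSwinnertonDyer.BirchSwinnertonDyer.Theorems.QuadraticBranchSignedControlPlusEtaNonsurjCorpuzLeiTransferOPEN
import Summits.BirchSwinnertonDyer.BirchSwinnertonDyer.Theorems.QuadraticBranchSignedControlPlusEtaNonsurjModFiveCongruenceRecordsE
import Summits.BirchSwinnertonDyer.BirchSwinnertonDyer.Theorems.QuadraticBranchSignedControlPlusEtaNonsurjModFiveCongruenceRecordsF
import Summits.BirchSwinnertonDyer.BirchSwinnertonDyer.Theorems.QuadraticBranchSignedControlPlusEtaNonsurjCMAnchorTransferRecordsA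
import HarnessLib

/-!
# Route `QuadraticBranchSignedControl` (rung K8, cell `bsd-potss`), residual crux `PlusEtaMainConjectureNonsurj`
# (stmt-BirchSwinnertonDyer-19606): the (A)-ANCHORED TRANSFER RECORDS — (C1⁺_η) at `p = 5` per row for the 16 non-CM rows of the crux in the
# mod-`5` classes of `2700p1` / `675a1` / `14400l1` / `11025b1`, part A: kernel facts (§0: minimality and CM of the four anchors, `11025b1` elliptic) + 4 rank-0 rows (a `--supports` file; seat `bsd-potss-k8eta-c2` g8; CORRECTION of the seat's
# unit-anchor records for these rows; nothing booked, BSD is not proved by any of this)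

WHY. This seat's unit-anchor transfer records (`EtaCMAnchorTransferRecords`, parts A–E) take a good `a_5 = 0` globally minimal model `V′` of the
CM UNIT ANCHOR's `5`-twist as a binder. For the four unit SIBLINGS `[0,0,0,0,−675]`, `[0,0,1,0,−169]`, `[0,0,0,0,800]`, `[0,0,1,0,−405169]`
(k8eta-c2 g7) `v₅(c₆) = 2`, so their `5`-twists have ADDITIVE reduction at `5` (`v₅(Δ_min) = 10`) and no such `V′` exists: those 16 records are
vacuous. The classes DO contain CM curves with a good `a_5 = 0` twist — the RANK-1 anchors of record `2700p1` = `[0,0,0,0,500]`, `675a1` =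
`[0,0,1,0,31]`, `14400l1` = `[0,0,0,0,1000]`, `11025b1` = `[0,0,1,0,1531]` (`v₅(c₆) = 3`). THIS FILE records the 16 rows through them with the
(A)-ANCHORED road `EtaCMConjAAnchorTransfer.quadraticBranchPlusEtaMainConjectureAt_of_cmConjAAnchor_of_transferFrame` (p558761): at the anchor's
twist `V″` (C1⁺_η) is k8eta-c2 g7's `EtaFineRoad.etaMC_cmRows_of_bt26_of_conjA_of_analyticMu` (Burungale–Tian `h26` + Kobayashi `h22 h6273` +
(A) at the anchor DISPLAYED — certified by Deo–Ray–Sujatha Thm 3.7, kit j277504 — + the analytic `μ` at `V″` DISPLAYED, PARI), and the transfer is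
the OPEN binder `CorpuzLei2025_etaPlusMainConjecture_transfer_anMu_OPEN` (analytic-`μ` anchor form; APPEND of `…CorpuzLeiTransferOPEN.lean`,
p558472). Congruence: twist-side kernel records `EtaModFiveCongruenceRecords.modPCongruent_twist5_<anchor>_<row>` (part E). Still NO hypothesis at
the ROW beyond its model — so the rank-1 non-prime-`L` rows 242325g1, 404325g1 and the rank-2 rows 162675m1, 242325h1 (the in-table residual of
`stub_etaMC_nonCM_lower` after g7) ARE covered, modulo (A)(675a1) + the PRE binder. Evidence grade: weaker than the unit-anchor road ((A) at a
rank-1 CM curve is Conjecture A, DRS-certified per anchor, not a theorem; analytic `μ` at the anchor twist displayed).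

HONEST FRAMING (cell `bsd-potss`; HUMAN RULING D-0036/D-0074): BOOKKEEPING THEOREMS ONLY — no definition, no new fact, no `sorry`, axioms standard;
CONDITIONAL on `hCL` (unrefereed preprint, flag `CL25-eta-plus-dictionary`), on `h26 h22 h6273` + one Fisher fact (named, published) and on the
displayed anchor inputs. 19606 stays OPEN; no stub is proved by name; nothing is booked; BSD(W,5) is claimed for no pair. `--supports stmt-BirchSwinnertonDyer-19606`.

References: [CorpuzLei2025] Thms 1–3 (claim); [BurungaleTian2026] Thm. 2.6; [Kobayashi2003] Thm. 2.2, §4, Thm. 6.2/6.3/7.3, Cor. 7.2;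
[CoatesSujatha2005] §3 (A); [DeoRaySujatha2023] Thm. 3.7; [Fisher2012Hessian] Thm. 13.2; [Fisher2013TwistsOfX5] Thm. 5.8; [Cremona1997] Table 1.
-/

set_option autoImplicit false
set_option linter.dupNamespace false

noncomputable section

open scoped Classical

open CongruenceSubgroup Field Function NumberField IsDedekindDomain WeierstrassCurve
open Literature.NumberTheory.EllipticCurves
open Literature.NumberTheory.EllipticCurves.ModularForms
open Literature.NumberTheory.EllipticCurves.Rank1Residual
open Literature.NumberTheory.EllipticCurves.Rank1Residual.Typed
open Literature.NumberTheory.GaloisRepresentations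
open Literature.NumberTheory.GaloisCohomology
open Literature.NumberTheory.EllipticCurves.IwasawaAlgebra
open Literature.NumberTheory.EllipticCurves.IwasawaDual ZpExtension
open Literature.NumberTheory.EllipticCurves.GreenbergVatsal2000
open Literature.NumberTheory.EllipticCurves.HesseFamilyFive (thm132_geomTorsionFive_of_hesseFamily
  thm58_geomTorsionFive_of_dualHesseFamily)
open Summit.BirchSwinnertonDyer.Rank1Residual.X11b.Levels
open Summit.BirchSwinnertonDyer.Rank1Residual.X11b
open Summit.BirchSwinnertonDyer.Rank1Residual.Additive
open Summit.BirchSwinnertonDyer.Rank1Residual.Additive.SignedTwist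
open scoped ContRepresentation
open Summit.BirchSwinnertonDyer.Rank1Residual.AdditivePotMult
open Summit.BirchSwinnertonDyer.Rank1Residual.O6 (ModPCongruent)

namespace Summit.BirchSwinnertonDyer.BirchSwinnertonDyer.Theorems

namespace EtaCMConjAAnchorTransferRecords

/-! ## §0 Kernel facts: the rank-1 CM anchors -/

set_option maxRecDepth 100000 in
/-- `2700p1` = `[0, 0, 0, 0, 500]` is a global minimal equation (Kraus/Silverman criterion on the support of `Δ`, kernel: `v(Δ) < 12` at every bad prime).
[cite: SilvermanAEC2009, VII.1 Remark 1.1] [cite: Kraus1989, Prop. 1 and Prop. 2] -/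
theorem isGloballyMinimal_2700p1 : (⟨0, 0, 0, 0, 500⟩ : WeierstrassCurve ℚ).IsGloballyMinimal :=
  isGloballyMinimal_of_krausCriterion_support 0 0 0 0 500 [(2, 1, 8), (3, 1, 3), (5, 1, 6)]
    (by decide +kernel) (by decide +kernel) (by decide +kernel)

set_option maxRecDepth 100000 in
/-- The rank-`1` CM anchor `2700p1` = `[0, 0, 0, 0, 500]` has CM: `j = c₄³/Δ = 0` is one of the thirteen CM `j`-invariants (kernel, `hasCM_iff_j_mem_holds`; pattern of
`EtaFineRoadRecords.hasCM_A2700`). [cite: SilvermanAEC2009, Appendix C §11] -/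
theorem hasCM_2700p1 : (⟨0, 0, 0, 0, 500⟩ : WeierstrassCurve ℚ).HasCM := by
  have hj := @EtaUnitRows.ratCurve_j 0 0 0 0 500 EtaFineRoadRecords.isElliptic_2700p1
  push_cast at hj
  haveI := EtaFineRoadRecords.isElliptic_2700p1
  exact (hasCM_iff_j_mem_holds _).mpr (by rw [hj]; decide +kernel)

set_option maxRecDepth 100000 in
/-- `675a1` = `[0, 0, 1, 0, 31]` is a global minimal equation (Kraus/Silverman criterion on the support of `Δ`, kernel: `v(Δ) < 12` at every bad prime).
[cite: SilvermanAEC2009, VII.1 Remark 1.1] [cite: Kraus1989, Prop. 1 and Prop. 2] -/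
theorem isGloballyMinimal_675a1 : (⟨0, 0, 1, 0, 31⟩ : WeierstrassCurve ℚ).IsGloballyMinimal :=
  isGloballyMinimal_of_krausCriterion_support 0 0 1 0 31 [(3, 1, 3), (5, 1, 6)]
    (by decide +kernel) (by decide +kernel) (by decide +kernel)

set_option maxRecDepth 100000 in
/-- The rank-`1` CM anchor `675a1` = `[0, 0, 1, 0, 31]` has CM: `j = c₄³/Δ = 0` is one of the thirteen CM `j`-invariants (kernel, `hasCM_iff_j_mem_holds`; pattern of
`EtaFineRoadRecords.hasCM_A2700`). [cite: SilvermanAEC2009, Appendix C §11] -/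
theorem hasCM_675a1 : (⟨0, 0, 1, 0, 31⟩ : WeierstrassCurve ℚ).HasCM := by
  have hj := @EtaUnitRows.ratCurve_j 0 0 1 0 31 EtaFineRoadRecords.isElliptic_675a1
  push_cast at hj
  haveI := EtaFineRoadRecords.isElliptic_675a1
  exact (hasCM_iff_j_mem_holds _).mpr (by rw [hj]; decide +kernel)

set_option maxRecDepth 100000 in
/-- `14400l1` = `[0, 0, 0, 0, 1000]` is a global minimal equation (Kraus/Silverman criterion on the support of `Δ`, kernel: `v(Δ) < 12` at every bad prime).
[cite: SilvermanAEC2009, VII.1 Remark 1.1] [cite: Kraus1989, Prop. 1 and Prop. 2] -/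
theorem isGloballyMinimal_14400l1 : (⟨0, 0, 0, 0, 1000⟩ : WeierstrassCurve ℚ).IsGloballyMinimal :=
  isGloballyMinimal_of_krausCriterion_support 0 0 0 0 1000 [(2, 1, 10), (3, 1, 3), (5, 1, 6)]
    (by decide +kernel) (by decide +kernel) (by decide +kernel)

set_option maxRecDepth 100000 in
/-- The rank-`1` CM anchor `14400l1` = `[0, 0, 0, 0, 1000]` has CM: `j = c₄³/Δ = 0` is one of the thirteen CM `j`-invariants (kernel, `hasCM_iff_j_mem_holds`; pattern of
`EtaFineRoadRecords.hasCM_A2700`). [cite: SilvermanAEC2009, Appendix C §11] -/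
theorem hasCM_14400l1 : (⟨0, 0, 0, 0, 1000⟩ : WeierstrassCurve ℚ).HasCM := by
  have hj := @EtaUnitRows.ratCurve_j 0 0 0 0 1000 EtaFineRoadRecords.isElliptic_14400l1
  push_cast at hj
  haveI := EtaFineRoadRecords.isElliptic_14400l1
  exact (hasCM_iff_j_mem_holds _).mpr (by rw [hj]; decide +kernel)

/-- The rank-`1` CM anchor `11025b1` = `[0, 0, 1, 0, 1531]`: `Δ ≠ 0` (kernel). [cite: Cremona1997, Table 1 (label 11025b1)] -/
theorem isElliptic_11025b1 : (⟨0, 0, 1, 0, 1531⟩ : WeierstrassCurve ℚ).IsElliptic :=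
  isElliptic_of_discOf_ne_zero 0 0 1 0 1531 (by decide +kernel)

set_option maxRecDepth 100000 in
/-- `11025b1` = `[0, 0, 1, 0, 1531]` is a global minimal equation (Kraus/Silverman criterion on the support of `Δ`, kernel: `v(Δ) < 12` at every bad prime).
[cite: SilvermanAEC2009, VII.1 Remark 1.1] [cite: Kraus1989, Prop. 1 and Prop. 2] -/
theorem isGloballyMinimal_11025b1 : (⟨0, 0, 1, 0, 1531⟩ : WeierstrassCurve ℚ).IsGloballyMinimal :=
  isGloballyMinimal_of_krausCriterion_support 0 0 1 0 1531 [(3, 1, 3), (5, 1, 6), (7, 1, 4)]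
    (by decide +kernel) (by decide +kernel) (by decide +kernel)

set_option maxRecDepth 100000 in
/-- The rank-`1` CM anchor `11025b1` = `[0, 0, 1, 0, 1531]` has CM: `j = c₄³/Δ = 0` is one of the thirteen CM `j`-invariants (kernel, `hasCM_iff_j_mem_holds`; pattern of
`EtaFineRoadRecords.hasCM_A2700`). [cite: SilvermanAEC2009, Appendix C §11] -/
theorem hasCM_11025b1 : (⟨0, 0, 1, 0, 1531⟩ : WeierstrassCurve ℚ).HasCM := by
  have hj := @EtaUnitRows.ratCurve_j 0 0 1 0 1531 isElliptic_11025b1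
  push_cast at hj
  haveI := isElliptic_11025b1
  exact (hasCM_iff_j_mem_holds _).mpr (by rw [hj]; decide +kernel)

/-! ## §1 Records -/

set_option maxRecDepth 100000 in
/-- **(C1⁺_η) at `p = 5` for every good `a_5 = 0` globally minimal model `V` of the `5`-twist of `78300bh1`**
(`[0, 0, 0, -705375, 135465750]`; non-CM, `Im ρ̄ = C_ns⁺(5)`, rank `0`; Cremona: `Tam = 10`, `#Ш_an = 1`) BY THE (A)-ANCHORED
TRANSFER ROAD (CORRECTION of this seat's unit-anchor record for the row, whose CM unit sibling has a `5`-twist ADDITIVE at `5`):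
the row is `5`-congruent to the RANK-1 CM anchor `2700p1` = `[0, 0, 0, 0, 500]` (twist good at `5`, `a_5 = 0`); on the twist
side `V″[5] ≃ V[5]` for ALL models is the kernel record `EtaModFiveCongruenceRecords.modPCongruent_twist5_2700p1_78300bh1`
(point `(λ:μ) = (600 : 1)` of the DIRECT Hesse family of the twisted anchor; Fisher's `thm132_geomTorsionFive_of_hesseFamily`
only); at the anchor's twist `V″` (C1⁺_η) is k8eta-c2 g7's `EtaFineRoad.etaMC_cmRows_of_bt26_of_conjA_of_analyticMu` from
(A)(`2700p1`,5) (`hAA`, DISPLAYED — DRS-3.7 certificate kit j277504) and the analytic `μ` at `V″` (displayed binder) modulo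
`h26 h22 h6273`; the transfer is the OPEN binder `hCL` (Corpuz–Lei 2025 Thms 1–3 at `i = (p−1)/2`, analytic-`μ` anchor form,
PREPRINT). NO hypothesis on the row beyond its model (no rank, no `L`-value, no `L_5⁺`-shape, no analytic `μ`, no Thm 4.1, no
Hatley–Lei, no Poitou–Tate, no Kitajima–Otsuki, no (A) at the row, no `L₀`). CONDITIONAL on `hCL` (PRE), `h26 h22 h6273`, one
Fisher fact and the displayed anchor inputs; nothing booked; BSD(W,5) claimed for no pair.
[claim: CorpuzLei2025, status: under-review] [cite: Fisher2012Hessian, Thm. 13.2 (i)] [cite: BurungaleTian2026, Thm. 2.6]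
[cite: CoatesSujatha2005, §3 statement (A)] [cite: DeoRaySujatha2023, Thm. 3.7]
[cite: Kobayashi2003, §4 Even main conjecture (p. 8)] [cite: Cremona1997, Table 1 (labels 78300bh1, 2700p1)] -/
theorem etaMC_78300bh1_5_cmConjAAnchorTransfer (hCL : CorpuzLei2025_etaPlusMainConjecture_transfer_anMu_OPEN)
    (h26 : BurungaleTian2026.thm26_etaKatoSequences_charIdeal_upToP_of_cm)
    (h22 : Kobayashi2003.thm22_etaSignedSelmerDual_finite_torsion)
    (h6273 : Kobayashi2003.thm62_63_73_etaColemanPoitouTate) (hF : thm132_geomTorsionFive_of_hesseFamily)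
    (W : WeierstrassCurve ℚ) (hW : W = ⟨0, 0, 0, (-705375), 135465750⟩) (A : WeierstrassCurve ℚ) (hA : A = ⟨0, 0, 0, 0, 500⟩)
    (hAA : ∀ (κ : ZpExtension ℚ 5), κ.IsCyclotomic →
      ∃ (γ : absoluteGaloisGroup ℚ) (D : A.FineSelmerDualData κ γ),
        Module.Finite ℤ_[5] (RestrictScalars ℤ_[5] (IwasawaAlgebra 5) D.X)) :
    ∀ (V'' : WeierstrassCurve ℚ) [V''.IsElliptic] [V''.IsGloballyMinimal]
      (V : WeierstrassCurve ℚ) [V.IsElliptic] [V.IsGloballyMinimal] [Fact (5 : ℕ).Prime],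
      (∃ C'' : VariableChange ℚ, C'' • A.quadraticTwist (5) = V'') →
      V''.HasGoodReductionAtPrime 5 → V''.frobeniusTrace 5 = 0 →
      (∀ {N : ℕ} [NeZero N] {f : CuspForm (Gamma0 N) 2}, IsNewformOf V'' f →
        ∀ (ϖ : ℚ), (if Even (5 / 2) then (ϖ : ℝ) * V''.realPeriodRat = plusPeriod f
            else (ϖ : ℝ) * V''.imaginaryPeriodRat = minusPeriod f) →
        ∀ (Lη : IwasawaAlgebra 5), IsQuadraticBranchPlusLFunction f 5 ϖ Lη → HasUnitContent Lη) →
      (∃ C : VariableChange ℚ, C • W.quadraticTwist (5) = V) →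
      V.HasGoodReductionAtPrime 5 → V.frobeniusTrace 5 = 0 →
      QuadraticBranchPlusEtaMainConjectureAt V 5 := by
  intro V'' _ _ V _ _ _ hC'' hgood'' hap'' hμan hC hgood hap
  subst hW; subst hA
  haveI := EtaFineRoadRecords.isElliptic_2700p1
  haveI := isGloballyMinimal_2700p1
  haveI := EtaFineRoadRecords.isElliptic_78300bh1
  have hcong : ModPCongruent V'' V 5 :=
    EtaModFiveCongruenceRecords.modPCongruent_twist5_2700p1_78300bh1 hF _ _ rfl rfl V'' V hC'' hC
  obtain ⟨C'', hC''V''⟩ := hC''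
  have hD : ((-1 : ℚ) ^ ((5 : ℕ) / 2) * ((5 : ℕ) : ℚ)) = 5 := by norm_num
  exact EtaCMConjAAnchorTransfer.quadraticBranchPlusEtaMainConjectureAt_of_cmConjAAnchor_of_transferFrame 5 hCL h26 h22 h6273
    (le_refl 5) _ hasCM_2700p1 hAA V'' C'' (by rw [hD]; exact hC''V'') hgood'' hap'' hμan V hgood hap hcong

set_option maxRecDepth 100000 in
/-- **(C1⁺_η) at `p = 5` for every good `a_5 = 0` globally minimal model `V` of the `5`-twist of `159300l1`**
(`[0, 0, 0, -121125, 12756625]`; non-CM, `Im ρ̄ = C_ns⁺(5)`, rank `0`; Cremona: `Tam = 10`, `#Ш_an = 1`) BY THE (A)-ANCHORED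
TRANSFER ROAD (CORRECTION of this seat's unit-anchor record for the row, whose CM unit sibling has a `5`-twist ADDITIVE at `5`):
the row is `5`-congruent to the RANK-1 CM anchor `2700p1` = `[0, 0, 0, 0, 500]` (twist good at `5`, `a_5 = 0`); on the twist
side `V″[5] ≃ V[5]` for ALL models is the kernel record `EtaModFiveCongruenceRecords.modPCongruent_twist5_2700p1_159300l1`
(point `(λ:μ) = (600 : 1)` of the INDIRECT Hesse family of the twisted anchor; Fisher's
`thm58_geomTorsionFive_of_dualHesseFamily` only); at the anchor's twist `V″` (C1⁺_η) is k8eta-c2 g7's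
`EtaFineRoad.etaMC_cmRows_of_bt26_of_conjA_of_analyticMu` from (A)(`2700p1`,5) (`hAA`, DISPLAYED — DRS-3.7 certificate kit
j277504) and the analytic `μ` at `V″` (displayed binder) modulo `h26 h22 h6273`; the transfer is the OPEN binder `hCL`
(Corpuz–Lei 2025 Thms 1–3 at `i = (p−1)/2`, analytic-`μ` anchor form, PREPRINT). NO hypothesis on the row beyond its model (no
rank, no `L`-value, no `L_5⁺`-shape, no analytic `μ`, no Thm 4.1, no Hatley–Lei, no Poitou–Tate, no Kitajima–Otsuki, no (A) at
the row, no `L₀`). CONDITIONAL on `hCL` (PRE), `h26 h22 h6273`, one Fisher fact and the displayed anchor inputs; nothing booked;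
BSD(W,5) claimed for no pair. [claim: CorpuzLei2025, status: under-review] [cite: Fisher2013TwistsOfX5, Thm. 5.8]
[cite: BurungaleTian2026, Thm. 2.6] [cite: CoatesSujatha2005, §3 statement (A)] [cite: DeoRaySujatha2023, Thm. 3.7]
[cite: Kobayashi2003, §4 Even main conjecture (p. 8)] [cite: Cremona1997, Table 1 (labels 159300l1, 2700p1)] -/
theorem etaMC_159300l1_5_cmConjAAnchorTransfer (hCL : CorpuzLei2025_etaPlusMainConjecture_transfer_anMu_OPEN)
    (h26 : BurungaleTian2026.thm26_etaKatoSequences_charIdeal_upToP_of_cm)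
    (h22 : Kobayashi2003.thm22_etaSignedSelmerDual_finite_torsion)
    (h6273 : Kobayashi2003.thm62_63_73_etaColemanPoitouTate) (hF : thm58_geomTorsionFive_of_dualHesseFamily)
    (W : WeierstrassCurve ℚ) (hW : W = ⟨0, 0, 0, (-121125), 12756625⟩) (A : WeierstrassCurve ℚ) (hA : A = ⟨0, 0, 0, 0, 500⟩)
    (hAA : ∀ (κ : ZpExtension ℚ 5), κ.IsCyclotomic →
      ∃ (γ : absoluteGaloisGroup ℚ) (D : A.FineSelmerDualData κ γ),
        Module.Finite ℤ_[5] (RestrictScalars ℤ_[5] (IwasawaAlgebra 5) D.X)) :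
    ∀ (V'' : WeierstrassCurve ℚ) [V''.IsElliptic] [V''.IsGloballyMinimal]
      (V : WeierstrassCurve ℚ) [V.IsElliptic] [V.IsGloballyMinimal] [Fact (5 : ℕ).Prime],
      (∃ C'' : VariableChange ℚ, C'' • A.quadraticTwist (5) = V'') →
      V''.HasGoodReductionAtPrime 5 → V''.frobeniusTrace 5 = 0 →
      (∀ {N : ℕ} [NeZero N] {f : CuspForm (Gamma0 N) 2}, IsNewformOf V'' f →
        ∀ (ϖ : ℚ), (if Even (5 / 2) then (ϖ : ℝ) * V''.realPeriodRat = plusPeriod f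
            else (ϖ : ℝ) * V''.imaginaryPeriodRat = minusPeriod f) →
        ∀ (Lη : IwasawaAlgebra 5), IsQuadraticBranchPlusLFunction f 5 ϖ Lη → HasUnitContent Lη) →
      (∃ C : VariableChange ℚ, C • W.quadraticTwist (5) = V) →
      V.HasGoodReductionAtPrime 5 → V.frobeniusTrace 5 = 0 →
      QuadraticBranchPlusEtaMainConjectureAt V 5 := by
  intro V'' _ _ V _ _ _ hC'' hgood'' hap'' hμan hC hgood hap
  subst hW; subst hA
  haveI := EtaFineRoadRecords.isElliptic_2700p1
  haveI := isGloballyMinimal_2700p1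
  haveI := EtaFineRoadRecords.isElliptic_159300l1
  have hcong : ModPCongruent V'' V 5 :=
    EtaModFiveCongruenceRecords.modPCongruent_twist5_2700p1_159300l1 hF _ _ rfl rfl V'' V hC'' hC
  obtain ⟨C'', hC''V''⟩ := hC''
  have hD : ((-1 : ℚ) ^ ((5 : ℕ) / 2) * ((5 : ℕ) : ℚ)) = 5 := by norm_num
  exact EtaCMConjAAnchorTransfer.quadraticBranchPlusEtaMainConjectureAt_of_cmConjAAnchor_of_transferFrame 5 hCL h26 h22 h6273
    (le_refl 5) _ hasCM_2700p1 hAA V'' C'' (by rw [hD]; exact hC''V'') hgood'' hap'' hμan V hgood hap hcong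

set_option maxRecDepth 100000 in
/-- **(C1⁺_η) at `p = 5` for every good `a_5 = 0` globally minimal model `V` of the `5`-twist of `162675n1`**
(`[0, 0, 1, -10374750, -13063103719]`; non-CM, `Im ρ̄ = C_ns⁺(5)`, rank `0`; Cremona: `Tam = 10`, `#Ш_an = 4`) BY THE
(A)-ANCHORED TRANSFER ROAD (CORRECTION of this seat's unit-anchor record for the row, whose CM unit sibling has a `5`-twist
ADDITIVE at `5`): the row is `5`-congruent to the RANK-1 CM anchor `675a1` = `[0, 0, 1, 0, 31]` (twist good at `5`, `a_5 = 0`);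
on the twist side `V″[5] ≃ V[5]` for ALL models is the kernel record
`EtaModFiveCongruenceRecords.modPCongruent_twist5_675a1_162675n1` (point `(λ:μ) = (600 : 1)` of the DIRECT Hesse family of the
twisted anchor; Fisher's `thm132_geomTorsionFive_of_hesseFamily` only); at the anchor's twist `V″` (C1⁺_η) is k8eta-c2 g7's
`EtaFineRoad.etaMC_cmRows_of_bt26_of_conjA_of_analyticMu` from (A)(`675a1`,5) (`hAA`, DISPLAYED — DRS-3.7 certificate kit
j277504) and the analytic `μ` at `V″` (displayed binder) modulo `h26 h22 h6273`; the transfer is the OPEN binder `hCL`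
(Corpuz–Lei 2025 Thms 1–3 at `i = (p−1)/2`, analytic-`μ` anchor form, PREPRINT). NO hypothesis on the row beyond its model (no
rank, no `L`-value, no `L_5⁺`-shape, no analytic `μ`, no Thm 4.1, no Hatley–Lei, no Poitou–Tate, no Kitajima–Otsuki, no (A) at
the row, no `L₀`). CONDITIONAL on `hCL` (PRE), `h26 h22 h6273`, one Fisher fact and the displayed anchor inputs; nothing booked;
BSD(W,5) claimed for no pair. [claim: CorpuzLei2025, status: under-review] [cite: Fisher2012Hessian, Thm. 13.2 (i)]
[cite: BurungaleTian2026, Thm. 2.6] [cite: CoatesSujatha2005, §3 statement (A)] [cite: DeoRaySujatha2023, Thm. 3.7]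
[cite: Kobayashi2003, §4 Even main conjecture (p. 8)] [cite: Cremona1997, Table 1 (labels 162675n1, 675a1)] -/
theorem etaMC_162675n1_5_cmConjAAnchorTransfer (hCL : CorpuzLei2025_etaPlusMainConjecture_transfer_anMu_OPEN)
    (h26 : BurungaleTian2026.thm26_etaKatoSequences_charIdeal_upToP_of_cm)
    (h22 : Kobayashi2003.thm22_etaSignedSelmerDual_finite_torsion)
    (h6273 : Kobayashi2003.thm62_63_73_etaColemanPoitouTate) (hF : thm132_geomTorsionFive_of_hesseFamily)
    (W : WeierstrassCurve ℚ) (hW : W = ⟨0, 0, 1, (-10374750), (-13063103719)⟩) (A : WeierstrassCurve ℚ) (hA : A = ⟨0, 0, 1, 0, 31⟩)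
    (hAA : ∀ (κ : ZpExtension ℚ 5), κ.IsCyclotomic →
      ∃ (γ : absoluteGaloisGroup ℚ) (D : A.FineSelmerDualData κ γ),
        Module.Finite ℤ_[5] (RestrictScalars ℤ_[5] (IwasawaAlgebra 5) D.X)) :
    ∀ (V'' : WeierstrassCurve ℚ) [V''.IsElliptic] [V''.IsGloballyMinimal]
      (V : WeierstrassCurve ℚ) [V.IsElliptic] [V.IsGloballyMinimal] [Fact (5 : ℕ).Prime],
      (∃ C'' : VariableChange ℚ, C'' • A.quadraticTwist (5) = V'') →
      V''.HasGoodReductionAtPrime 5 → V''.frobeniusTrace 5 = 0 →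
      (∀ {N : ℕ} [NeZero N] {f : CuspForm (Gamma0 N) 2}, IsNewformOf V'' f →
        ∀ (ϖ : ℚ), (if Even (5 / 2) then (ϖ : ℝ) * V''.realPeriodRat = plusPeriod f
            else (ϖ : ℝ) * V''.imaginaryPeriodRat = minusPeriod f) →
        ∀ (Lη : IwasawaAlgebra 5), IsQuadraticBranchPlusLFunction f 5 ϖ Lη → HasUnitContent Lη) →
      (∃ C : VariableChange ℚ, C • W.quadraticTwist (5) = V) →
      V.HasGoodReductionAtPrime 5 → V.frobeniusTrace 5 = 0 →
      QuadraticBranchPlusEtaMainConjectureAt V 5 := by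
  intro V'' _ _ V _ _ _ hC'' hgood'' hap'' hμan hC hgood hap
  subst hW; subst hA
  haveI := EtaFineRoadRecords.isElliptic_675a1
  haveI := isGloballyMinimal_675a1
  haveI := EtaFineRoadRecords.isElliptic_162675n1
  have hcong : ModPCongruent V'' V 5 :=
    EtaModFiveCongruenceRecords.modPCongruent_twist5_675a1_162675n1 hF _ _ rfl rfl V'' V hC'' hC
  obtain ⟨C'', hC''V''⟩ := hC''
  have hD : ((-1 : ℚ) ^ ((5 : ℕ) / 2) * ((5 : ℕ) : ℚ)) = 5 := by norm_num
  exact EtaCMConjAAnchorTransfer.quadraticBranchPlusEtaMainConjectureAt_of_cmConjAAnchor_of_transferFrame 5 hCL h26 h22 h6273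
    (le_refl 5) _ hasCM_675a1 hAA V'' C'' (by rw [hD]; exact hC''V'') hgood'' hap'' hμan V hgood hap hcong

set_option maxRecDepth 100000 in
/-- **(C1⁺_η) at `p = 5` for every good `a_5 = 0` globally minimal model `V` of the `5`-twist of `164700i1`**
(`[0, 0, 0, -119963625, -505734387375]`; non-CM, `Im ρ̄ = C_ns⁺(5)`, rank `0`; Cremona: `Tam = 30`, `#Ш_an = 1`) BY THE
(A)-ANCHORED TRANSFER ROAD (CORRECTION of this seat's unit-anchor record for the row, whose CM unit sibling has a `5`-twist
ADDITIVE at `5`): the row is `5`-congruent to the RANK-1 CM anchor `2700p1` = `[0, 0, 0, 0, 500]` (twist good at `5`,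
`a_5 = 0`); on the twist side `V″[5] ≃ V[5]` for ALL models is the kernel record
`EtaModFiveCongruenceRecords.modPCongruent_twist5_2700p1_164700i1` (point `(λ:μ) = (1200 : 1)` of the DIRECT Hesse family of the
twisted anchor; Fisher's `thm132_geomTorsionFive_of_hesseFamily` only); at the anchor's twist `V″` (C1⁺_η) is k8eta-c2 g7's
`EtaFineRoad.etaMC_cmRows_of_bt26_of_conjA_of_analyticMu` from (A)(`2700p1`,5) (`hAA`, DISPLAYED — DRS-3.7 certificate kit
j277504) and the analytic `μ` at `V″` (displayed binder) modulo `h26 h22 h6273`; the transfer is the OPEN binder `hCL`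
(Corpuz–Lei 2025 Thms 1–3 at `i = (p−1)/2`, analytic-`μ` anchor form, PREPRINT). NO hypothesis on the row beyond its model (no
rank, no `L`-value, no `L_5⁺`-shape, no analytic `μ`, no Thm 4.1, no Hatley–Lei, no Poitou–Tate, no Kitajima–Otsuki, no (A) at
the row, no `L₀`). CONDITIONAL on `hCL` (PRE), `h26 h22 h6273`, one Fisher fact and the displayed anchor inputs; nothing booked;
BSD(W,5) claimed for no pair. [claim: CorpuzLei2025, status: under-review] [cite: Fisher2012Hessian, Thm. 13.2 (i)]
[cite: BurungaleTian2026, Thm. 2.6] [cite: CoatesSujatha2005, §3 statement (A)] [cite: DeoRaySujatha2023, Thm. 3.7]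
[cite: Kobayashi2003, §4 Even main conjecture (p. 8)] [cite: Cremona1997, Table 1 (labels 164700i1, 2700p1)] -/
theorem etaMC_164700i1_5_cmConjAAnchorTransfer (hCL : CorpuzLei2025_etaPlusMainConjecture_transfer_anMu_OPEN)
    (h26 : BurungaleTian2026.thm26_etaKatoSequences_charIdeal_upToP_of_cm)
    (h22 : Kobayashi2003.thm22_etaSignedSelmerDual_finite_torsion)
    (h6273 : Kobayashi2003.thm62_63_73_etaColemanPoitouTate) (hF : thm132_geomTorsionFive_of_hesseFamily)
    (W : WeierstrassCurve ℚ) (hW : W = ⟨0, 0, 0, (-119963625), (-505734387375)⟩) (A : WeierstrassCurve ℚ) (hA : A = ⟨0, 0, 0, 0, 500⟩)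
    (hAA : ∀ (κ : ZpExtension ℚ 5), κ.IsCyclotomic →
      ∃ (γ : absoluteGaloisGroup ℚ) (D : A.FineSelmerDualData κ γ),
        Module.Finite ℤ_[5] (RestrictScalars ℤ_[5] (IwasawaAlgebra 5) D.X)) :
    ∀ (V'' : WeierstrassCurve ℚ) [V''.IsElliptic] [V''.IsGloballyMinimal]
      (V : WeierstrassCurve ℚ) [V.IsElliptic] [V.IsGloballyMinimal] [Fact (5 : ℕ).Prime],
      (∃ C'' : VariableChange ℚ, C'' • A.quadraticTwist (5) = V'') →
      V''.HasGoodReductionAtPrime 5 → V''.frobeniusTrace 5 = 0 →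
      (∀ {N : ℕ} [NeZero N] {f : CuspForm (Gamma0 N) 2}, IsNewformOf V'' f →
        ∀ (ϖ : ℚ), (if Even (5 / 2) then (ϖ : ℝ) * V''.realPeriodRat = plusPeriod f
            else (ϖ : ℝ) * V''.imaginaryPeriodRat = minusPeriod f) →
        ∀ (Lη : IwasawaAlgebra 5), IsQuadraticBranchPlusLFunction f 5 ϖ Lη → HasUnitContent Lη) →
      (∃ C : VariableChange ℚ, C • W.quadraticTwist (5) = V) →
      V.HasGoodReductionAtPrime 5 → V.frobeniusTrace 5 = 0 →
      QuadraticBranchPlusEtaMainConjectureAt V 5 := by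
  intro V'' _ _ V _ _ _ hC'' hgood'' hap'' hμan hC hgood hap
  subst hW; subst hA
  haveI := EtaFineRoadRecords.isElliptic_2700p1
  haveI := isGloballyMinimal_2700p1
  haveI := EtaFineRoadRecords.isElliptic_164700i1
  have hcong : ModPCongruent V'' V 5 :=
    EtaModFiveCongruenceRecords.modPCongruent_twist5_2700p1_164700i1 hF _ _ rfl rfl V'' V hC'' hC
  obtain ⟨C'', hC''V''⟩ := hC''
  have hD : ((-1 : ℚ) ^ ((5 : ℕ) / 2) * ((5 : ℕ) : ℚ)) = 5 := by norm_num
  exact EtaCMConjAAnchorTransfer.quadraticBranchPlusEtaMainConjectureAt_of_cmConjAAnchor_of_transferFrame 5 hCL h26 h22 h6273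
    (le_refl 5) _ hasCM_2700p1 hAA V'' C'' (by rw [hD]; exact hC''V'') hgood'' hap'' hμan V hgood hap hcong

end EtaCMConjAAnchorTransferRecords

end Summit.BirchSwinnertonDyer.BirchSwinnertonDyer.Theorems

end
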